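import Mathlib
import Summits.Ventures.PercRepro2.Defs
import Summits.Ventures.PercRepro2.Independence
import Summits.Ventures.PercRepro2.Harris
import Summits.Ventures.PercRepro2.Graph
import Summits.Ventures.PercRepro2.Exploration
import Summits.Ventures.PercRepro2.Events
import Summits.Ventures.PercRepro2.FourFunctions
import Summits.Ventures.PercRepro2.Induced
import Summits.Ventures.PercRepro2.Frontier
import Summits.Ventures.PercRepro2.ObsIndependence
import Summits.Ventures.PercRepro2.BHK
import Summits.Ventures.PercRepro2.BHKEvents
import Summits.Ventures.PercRepro2.BHKAvoid
import Summits.Ventures.PercRepro2.SameClusterAvoid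
import Summits.Ventures.PercRepro2.CaseOneRegime
import Summits.Ventures.PercRepro2.CaseOnePos
import Summits.Ventures.PercRepro2.CaseOneJ11
import Summits.Ventures.PercRepro2.CaseOneRV
import Summits.Ventures.PercRepro2.PathMixBHK
import Summits.Ventures.PercRepro2.CylinderCond
import Summits.Ventures.PercRepro2.CylinderCov
import Summits.Ventures.PercRepro2.PathMixKernel
import Summits.Ventures.PercRepro2.Explore

/-!
# PATHMIX for every stopping rule: the bridge from typer-1's `Explore.StoppingRule` to the cylinder
partitions of `PathMixKernel` (blind cell PercRepro2, p1 g13; lead g24 00:15Z / 00:21Z, typer-1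
00:21Z)

A stopping rule (`Explore.StoppingRule`: a record `T(ω) = (op, cl)` of explored edges, consistent
and depending only on the explored edges) whose records on `{a₃ ∈ C₁}` DECIDE `{a₃ ∈ C₁}`
(`T(ω).cyl ⊆ {a₃ ∈ C₁}` whenever `a₃ ∈ C₁(ω)` — the rule halts when `a₃` joins, so the record shows
an open path `a₁ → a₃`) yields a `CylinderCov.IsCylinderPartition` of `{a₃ ∈ C₁}`: the records of the
configurations of `{a₃ ∈ C₁}` with `F T = T.explored`, `σ T = 1 on T.op` (**`isCylinderPartition_records`**;
cover = `consistent`, sub = the deciding hypothesis, disj = `stopping`). The record's cylinder and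
weights are the cylinder and the conditioned weights of `CylinderCond.lean` (**`cylinder_record`**,
**`condWeights_record`**: `T.weights p = condWeights p T.explored σ_T = modWeights p T.op T.cl`).
Hence **`zSplitII_of_pm_rule`** / **`rv_of_pm_rule`**: for EVERY such stopping rule,
`0 ≤ pmExpr (records) ⟹ (ii) ⟹ (RV)` — PATHMIX in the kernel for any exploration order; the
canonical a₁-rooted «stop when a₃ joins» exploration is one instance. Nothing about `PM ≥ 0` is
claimed. -/

namespace Summit.Ventures.PercRepro2

namespace PathMix

open Explore CylinderCond CylinderCov

section RecordCyl
variable {E : Type*} [DecidableEq E]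

/-- The state vector of a record: `true` on the explored-open edges. -/
def recSigma (T : Record E) : Config E := fun e => decide (e ∈ T.op)

omit [DecidableEq E] in
/-- On the explored-closed edges the state vector is `false`. -/
lemma recSigma_of_mem_cl [DecidableEq E] (T : Record E) {e : E} (h : e ∈ T.cl) :
    recSigma T e = false := by
  unfold recSigma
  have : e ∉ T.op := Finset.disjoint_right.1 T.disj h
  simp [this]

/-- The cylinder of a record is the cylinder of its explored edges with its state vector. -/
theorem cylinder_record (T : Record E) : cylinder T.explored (recSigma T) = T.cyl := by
  ext ω
  simp only [mem_cylinder, Record.mem_cyl, Record.explored, Finset.mem_union]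
  constructor
  · intro h
    refine ⟨fun e he => ?_, fun e he => ?_⟩
    · rw [h e (Or.inl he)]
      simp [recSigma, he]
    · rw [h e (Or.inr he), recSigma_of_mem_cl T he]
  · rintro ⟨h1, h2⟩ e he
    rcases he with he | he
    · rw [h1 e he]; simp [recSigma, he]
    · rw [h2 e he, recSigma_of_mem_cl T he]

variable {R : Type*} [CommRing R]

/-- The conditioned weights of a record's cylinder are its pinned weights. -/
theorem condWeights_record (p : E → R) (T : Record E) :
    condWeights p T.explored (recSigma T) = T.weights p := by
  funext e
  unfold condWeights Record.weights recSigma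
  by_cases ho : e ∈ T.op
  · simp [ho, Record.explored]
  · by_cases hc : e ∈ T.cl
    · simp [ho, hc, Record.explored]
    · simp [ho, hc, Record.explored]

end RecordCyl

section Partition
variable {E : Type*} [Fintype E] [DecidableEq E]

/-- **The records of the configurations of `A` form a cylinder partition of `A`** whenever the rule
decides `A` (`T(ω).cyl ⊆ A` for `ω ∈ A`). -/
theorem isCylinderPartition_records (rule : StoppingRule E) (A : Set (Config E))
    [DecidablePred (· ∈ A)] (hA : ∀ ω ∈ A, (rule.record ω).cyl ⊆ A) :
    IsCylinderPartition ((Finset.univ.filter (· ∈ A)).image rule.record) Record.explored recSigma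
      A := by
  classical
  refine ⟨?_, ?_, ?_⟩
  · intro ω hω
    refine ⟨rule.record ω, Finset.mem_image_of_mem _ (Finset.mem_filter.2 ⟨Finset.mem_univ _, hω⟩),
      ?_⟩
    rw [cylinder_record]
    exact rule.consistent ω
  · intro T hT
    obtain ⟨ω, hω, rfl⟩ := Finset.mem_image.1 hT
    rw [cylinder_record]
    exact hA ω (Finset.mem_filter.1 hω).2
  · intro T hT T' hT' hne
    obtain ⟨ω, _, rfl⟩ := Finset.mem_image.1 hT
    obtain ⟨ω', _, rfl⟩ := Finset.mem_image.1 hT'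
    rw [cylinder_record, cylinder_record]
    rw [Set.disjoint_left]
    intro ω₁ h₁ h₂
    apply hne
    rw [← (rule.record_eq_iff_mem_cyl ω ω₁).2 h₁, ← (rule.record_eq_iff_mem_cyl ω' ω₁).2 h₂]

end Partition

section Kernel
variable {V : Type*} {E : Type*} [Fintype E] [DecidableEq E] [Fintype V] [DecidableEq V]
  {R : Type*} [Field R] [LinearOrder R] [IsStrictOrderedRing R]

/-- The records of the case-1 configurations of a rule. -/
noncomputable def caseOneRecords (rule : StoppingRule E) (ends : E → Sym2 V) (a₁ a₃ : V) :
    Finset (Record E) := by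
  classical
  exact (Finset.univ.filter (· ∈ connEvent ends a₁ a₃)).image rule.record

/-- **PATHMIX for every stopping rule**: if the rule decides `{a₃ ∈ C₁}` and `P(Q), D, M > 0`, then
`0 ≤ pmExpr (case-1 records) ⟹ (ii)`. -/
theorem zSplitII_of_pm_rule (rule : StoppingRule E) (p : E → R) (hp : IsProbVec p)
    (ends : E → Sym2 V) (o a₁ a₂ a₃ b : V)
    (hA : ∀ ω ∈ connEvent ends a₁ a₃, (rule.record ω).cyl ⊆ connEvent ends a₁ a₃)
    (hQ : 0 < prob p (connEvent ends a₁ a₂)ᶜ) (hD : 0 < CaseOne.Dpd p ends a₁ a₂ a₃)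
    (hM : 0 < ∑ T ∈ caseOneRecords rule ends a₁ a₃,
      recC p Record.explored recSigma T * recM p ends a₁ a₂ Record.explored recSigma T)
    (hpm : 0 ≤ pmExpr p ends o a₁ a₂ a₃ b (caseOneRecords rule ends a₁ a₃) Record.explored recSigma) :
    CaseOne.ZSplitII p ends o a₁ a₂ a₃ b := by
  classical
  have hpart := isCylinderPartition_records rule (connEvent ends a₁ a₃) hA
  exact zSplitII_of_pm p hp ends o a₁ a₂ a₃ b hpart hQ hD hM hpm

/-- **`PM ≥ 0 ⟹ (RV)` for every stopping rule** (when the required-vertex world has positive mass). -/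
theorem rv_of_pm_rule (rule : StoppingRule E) (p : E → R) (hp : IsProbVec p)
    (ends : E → Sym2 V) (o a₁ a₂ a₃ b : V)
    (hA : ∀ ω ∈ connEvent ends a₁ a₃, (rule.record ω).cyl ⊆ connEvent ends a₁ a₃)
    (hQ : 0 < prob p (connEvent ends a₁ a₂)ᶜ) (hD : 0 < CaseOne.Dpd p ends a₁ a₂ a₃)
    (hM : 0 < ∑ T ∈ caseOneRecords rule ends a₁ a₃,
      recC p Record.explored recSigma T * recM p ends a₁ a₂ Record.explored recSigma T)
    (hT : 0 < prob p (CaseOne.Tp ends a₁ a₂ a₃))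
    (hpm : 0 ≤ pmExpr p ends o a₁ a₂ a₃ b (caseOneRecords rule ends a₁ a₃) Record.explored recSigma) :
    CaseOne.RV p ends o a₁ a₂ a₃ b :=
  (CaseOne.rv_iff_ii p ends o a₁ a₂ a₃ b hT).2
    (zSplitII_of_pm_rule rule p hp ends o a₁ a₂ a₃ b hA hQ hD hM hpm)

end Kernel

end PathMix

end Summit.Ventures.PercRepro2
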